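import Summits.NavierStokesRegularity.NavierStokesRegularity.Theorems.HeredityAtOne.Negative.HeredityAtOneFalseOfCappedStageAtOne

/-!
# KJ-14 — the cap class `(𝒜, Φ)` of `CappedStageAt k` is ELIMINABLE: `H_cap(k)` is exactly
«one registered level-`k` stage whose `τ_k`-state has a speed-bounded unforced future below the next floor»

Refuter hygiene for the negative lemma `HeredityAtOne_false_of_CappedStageAtOne` (item 19249, plain
Negative lane). The hypothesis `CappedStageAt k` quantifies EXISTENTIALLY over a «printed window speed cap»
`(𝒜, Φ)` (`WindowSpeedCap 𝒜 Φ`), but nothing in the type ties `(𝒜, Φ)` to any printed class: taking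
`𝒜 := {s.u(τ_k)}` and `Φ := const B` shows

* `cappedStageAt_iff_exists_speed_bound` — `CappedStageAt k ↔ ∃ S s B, Pins ∧ Rigid ∧ Quiet ∧ B < c₁ Y_{k+1} ∧`
  every finite-energy classical solution of the UNFORCED system on any slab `[a, b]` starting from the
  state `s.u(τ_k)` has speed `≤ B` everywhere on the slab (both directions one line: `B := Φ(s.u(τ_k))`,
  resp. the singleton class with the constant cap).

So `H_cap(k)` carries no literature content of its own; it is an honest DYNAMICAL hypothesis on ONE
registered state (all its unforced finite-energy classical continuations stay below the next floor for
all time) — strictly stronger than `¬ HeredityAt k`, which it implies (`not_heredityAt_of_cappedStageAt`):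
heredity can also fail by blow-up, by the ceiling, or by the energy clause, none of which `H_cap` covers.
It is not satisfiable by junk either: as soon as ONE unforced continuation from the state exists (forward
local existence), the bound `B` dominates the state's own level-`k` floor,
`floor_le_speed_bound` — `c₁ Y_k ≤ B` — so the admissible window for `B` is `[c₁ Y_k, c₁ Y_{k+1})`, a factor
`Y_{k+1}/Y_k` (`≈ 2.21` at `k = 1` on the wide register): the state was just amplified to its floor and
must not amplify by that factor ever again. The Gallay–Šverák bound (Prop. 2.6 with the Feng–Šverák
proof; sharp constant `√(3π/32)` in the `Ω`-normalisation, refuter memo KJ-13) is the TOOL one would use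
to establish such a `B` for a swirl-free single-signed state, not part of the hypothesis.

* `not_heredityFrom_of_speedBoundedStage` — against `HeredityFrom k` (`k ≥ 1`) ANY all-time speed bound
  `B` on the unforced future of one registered level-`k` state suffices (the singleton instance of
  `not_heredityFrom_of_cappedClassStage`): no numerical window at all.

WHAT THIS IS NOT: not NS — no stage, state or bound is constructed; pure logic over the landed file.
References: [cite: Palasek2026ElementaryModel, §4]; [cite: GallaySverak2016, Prop. 2.6].
-/

noncomputable section

namespace Summit.NavierStokesRegularity.HeredityAtOneSpeedCap

open Set MeasureTheory
open scoped ENNReal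
open Literature.Analysis.FluidPDE
open Summit.NavierStokesRegularity.FluidComputer.PalasekTowerClayBridge
open Summit.NavierStokesRegularity.NavierStokesRegularity

/-- The singleton class with a constant cap: `WindowSpeedCap {v} (const B)` says verbatim that every
finite-energy classical solution of the unforced system on a slab `[a, b]` with `u(a) = v` has speed `≤ B`
on the slab. [folklore] -/
theorem windowSpeedCap_singleton_const_iff (v : EuclideanSpace ℝ (Fin 3) → EuclideanSpace ℝ (Fin 3))
    (B : ℝ) :
    WindowSpeedCap {v} (fun _ => B) ↔
      ∀ ⦃a b : ℝ⦄, a < b →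
        ∀ (f u : ℝ → EuclideanSpace ℝ (Fin 3) → EuclideanSpace ℝ (Fin 3))
          (p : ℝ → EuclideanSpace ℝ (Fin 3) → ℝ),
          IsClassicalNSSolutionOn (Icc a b) 1 f u p → (∀ t ∈ Icc a b, f t = 0) →
          (∃ C : ℝ≥0∞, C < ⊤ ∧ ∀ t ∈ Icc a b, ∫⁻ x, ‖u t x‖ₑ ^ 2 ≤ C) →
          u a = v → ∀ t ∈ Icc a b, ∀ x, ‖u t x‖ ≤ B :=
  Iff.rfl

/-- **`H_cap(k)` with the cap class eliminated**: `CappedStageAt k` holds iff some pinned rigid quiet wide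
design carries a registered level-`k` stage `s` and a number `B < c₁ Y_{k+1}` bounding the speed of EVERY
finite-energy classical solution of the unforced system on any slab that starts from the state `s.u(τ_k)`.
(`→`: `B := Φ(s.u(τ_k))`; `←`: `𝒜 := {s.u(τ_k)}`, `Φ := const B`.) [cite: Palasek2026ElementaryModel, §4] -/
theorem cappedStageAt_iff_exists_speed_bound (k : ℕ) :
    CappedStageAt k ↔
      ∃ (S : Schedule TowerRates.wide)
        (s : Stage 1 TowerRates.wide S (Margins.routeG TowerRates.wide) k) (B : ℝ),
        S.Pins 8 (6 / 5) ∧ S.Rigid ∧ S.Quiet ∧ B < S.c₁ * TowerRates.wide.Y (k + 1) ∧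
        ∀ ⦃a b : ℝ⦄, a < b →
          ∀ (f u : ℝ → EuclideanSpace ℝ (Fin 3) → EuclideanSpace ℝ (Fin 3))
            (p : ℝ → EuclideanSpace ℝ (Fin 3) → ℝ),
            IsClassicalNSSolutionOn (Icc a b) 1 f u p → (∀ t ∈ Icc a b, f t = 0) →
            (∃ C : ℝ≥0∞, C < ⊤ ∧ ∀ t ∈ Icc a b, ∫⁻ x, ‖u t x‖ₑ ^ 2 ≤ C) →
            u a = s.u (S.τ k) → ∀ t ∈ Icc a b, ∀ x, ‖u t x‖ ≤ B := by
  constructor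
  · rintro ⟨𝒜, Φ, hcap, S, s, hP, hR, hQ, hA, hΦ⟩
    refine ⟨S, s, Φ (s.u (S.τ k)), hP, hR, hQ, hΦ, ?_⟩
    intro a b hab f u p hcl hf0 hE hua t ht x
    have hAa : u a ∈ 𝒜 := by rw [hua]; exact hA
    have h := hcap hab f u p hcl hf0 hE hAa t ht x
    rwa [hua] at h
  · rintro ⟨S, s, B, hP, hR, hQ, hB, hbd⟩
    refine ⟨{s.u (S.τ k)}, fun _ => B, ?_, S, s, hP, hR, hQ, Set.mem_singleton _, hB⟩
    intro a b hab f u p hcl hf0 hE hA t ht x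
    exact hbd hab f u p hcl hf0 hE (Set.mem_singleton_iff.1 hA) t ht x

/-- The first rung by name: `CappedStageAtOne` with the cap class eliminated. [cite: Palasek2026ElementaryModel, §4] -/
theorem cappedStageAtOne_iff_exists_speed_bound :
    CappedStageAtOne ↔
      ∃ (S : Schedule TowerRates.wide)
        (s : Stage 1 TowerRates.wide S (Margins.routeG TowerRates.wide) 1) (B : ℝ),
        S.Pins 8 (6 / 5) ∧ S.Rigid ∧ S.Quiet ∧ B < S.c₁ * TowerRates.wide.Y 2 ∧
        ∀ ⦃a b : ℝ⦄, a < b →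
          ∀ (f u : ℝ → EuclideanSpace ℝ (Fin 3) → EuclideanSpace ℝ (Fin 3))
            (p : ℝ → EuclideanSpace ℝ (Fin 3) → ℝ),
            IsClassicalNSSolutionOn (Icc a b) 1 f u p → (∀ t ∈ Icc a b, f t = 0) →
            (∃ C : ℝ≥0∞, C < ⊤ ∧ ∀ t ∈ Icc a b, ∫⁻ x, ‖u t x‖ₑ ^ 2 ≤ C) →
            u a = s.u (S.τ 1) → ∀ t ∈ Icc a b, ∀ x, ‖u t x‖ ≤ B :=
  cappedStageAt_iff_exists_speed_bound 1

/-- **The bound is pinned from below by the state's own floor**: if `B` bounds the speed of every unforced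
finite-energy classical slab-continuation of the `τ_k`-state of a registered level-`k` stage and ONE such
continuation exists (forward local existence), then `c₁ Y_k ≤ B` — the level-`k` floor is read at
`t = τ_k` itself. Hence the admissible window of `H_cap(k)` is `c₁ Y_k ≤ B < c₁ Y_{k+1}`.
[cite: Palasek2026ElementaryModel, §4] -/
theorem floor_le_speed_bound {k : ℕ} {S : Schedule TowerRates.wide}
    (s : Stage 1 TowerRates.wide S (Margins.routeG TowerRates.wide) k) {B : ℝ}
    (hbd : ∀ ⦃a b : ℝ⦄, a < b →
      ∀ (f u : ℝ → EuclideanSpace ℝ (Fin 3) → EuclideanSpace ℝ (Fin 3))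
        (p : ℝ → EuclideanSpace ℝ (Fin 3) → ℝ),
        IsClassicalNSSolutionOn (Icc a b) 1 f u p → (∀ t ∈ Icc a b, f t = 0) →
        (∃ C : ℝ≥0∞, C < ⊤ ∧ ∀ t ∈ Icc a b, ∫⁻ x, ‖u t x‖ₑ ^ 2 ≤ C) →
        u a = s.u (S.τ k) → ∀ t ∈ Icc a b, ∀ x, ‖u t x‖ ≤ B)
    (hex : ∃ (a b : ℝ) (f u : ℝ → EuclideanSpace ℝ (Fin 3) → EuclideanSpace ℝ (Fin 3))
      (p : ℝ → EuclideanSpace ℝ (Fin 3) → ℝ),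
      a < b ∧ IsClassicalNSSolutionOn (Icc a b) 1 f u p ∧ (∀ t ∈ Icc a b, f t = 0) ∧
      (∃ C : ℝ≥0∞, C < ⊤ ∧ ∀ t ∈ Icc a b, ∫⁻ x, ‖u t x‖ₑ ^ 2 ≤ C) ∧ u a = s.u (S.τ k)) :
    S.c₁ * TowerRates.wide.Y k ≤ B := by
  obtain ⟨a, b, f, u, p, hab, hcl, hf0, hE, hua⟩ := hex
  obtain ⟨x, -, hfl⟩ := s.floor k le_rfl
  have h := hbd hab f u p hcl hf0 hE hua a ⟨le_rfl, hab.le⟩ x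
  rw [hua] at h
  exact hfl.trans h

/-- **The window of `H_cap(k)`**: under `CappedStageAt k` in its eliminated form, with one unforced
continuation of the state available, `c₁ Y_k ≤ B < c₁ Y_{k+1}`. [cite: Palasek2026ElementaryModel, §4] -/
theorem speed_bound_window {k : ℕ} {S : Schedule TowerRates.wide}
    (s : Stage 1 TowerRates.wide S (Margins.routeG TowerRates.wide) k) {B : ℝ}
    (hB : B < S.c₁ * TowerRates.wide.Y (k + 1))
    (hbd : ∀ ⦃a b : ℝ⦄, a < b →
      ∀ (f u : ℝ → EuclideanSpace ℝ (Fin 3) → EuclideanSpace ℝ (Fin 3))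
        (p : ℝ → EuclideanSpace ℝ (Fin 3) → ℝ),
        IsClassicalNSSolutionOn (Icc a b) 1 f u p → (∀ t ∈ Icc a b, f t = 0) →
        (∃ C : ℝ≥0∞, C < ⊤ ∧ ∀ t ∈ Icc a b, ∫⁻ x, ‖u t x‖ₑ ^ 2 ≤ C) →
        u a = s.u (S.τ k) → ∀ t ∈ Icc a b, ∀ x, ‖u t x‖ ≤ B)
    (hex : ∃ (a b : ℝ) (f u : ℝ → EuclideanSpace ℝ (Fin 3) → EuclideanSpace ℝ (Fin 3))
      (p : ℝ → EuclideanSpace ℝ (Fin 3) → ℝ),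
      a < b ∧ IsClassicalNSSolutionOn (Icc a b) 1 f u p ∧ (∀ t ∈ Icc a b, f t = 0) ∧
      (∃ C : ℝ≥0∞, C < ⊤ ∧ ∀ t ∈ Icc a b, ∫⁻ x, ‖u t x‖ₑ ^ 2 ≤ C) ∧ u a = s.u (S.τ k)) :
    S.c₁ * TowerRates.wide.Y k ≤ B ∧ B < S.c₁ * TowerRates.wide.Y (k + 1) :=
  ⟨floor_le_speed_bound s hbd hex, hB⟩

/-- **Against `HeredityFrom k` (`k ≥ 1`) no numerical window survives**: ONE registered level-`k` stage of a
pinned rigid quiet wide design whose `τ_k`-state has its unforced finite-energy classical slab-continuations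
bounded in speed by ANY number `B` refutes `HeredityFrom k` (the singleton instance of
`not_heredityFrom_of_cappedClassStage`). [cite: Palasek2026ElementaryModel, §4] -/
theorem not_heredityFrom_of_speedBoundedStage {k : ℕ} (hk : 1 ≤ k)
    (hW : ∃ (S : Schedule TowerRates.wide)
      (s : Stage 1 TowerRates.wide S (Margins.routeG TowerRates.wide) k) (B : ℝ),
      S.Pins 8 (6 / 5) ∧ S.Rigid ∧ S.Quiet ∧
      ∀ ⦃a b : ℝ⦄, a < b →
        ∀ (f u : ℝ → EuclideanSpace ℝ (Fin 3) → EuclideanSpace ℝ (Fin 3))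
          (p : ℝ → EuclideanSpace ℝ (Fin 3) → ℝ),
          IsClassicalNSSolutionOn (Icc a b) 1 f u p → (∀ t ∈ Icc a b, f t = 0) →
          (∃ C : ℝ≥0∞, C < ⊤ ∧ ∀ t ∈ Icc a b, ∫⁻ x, ‖u t x‖ₑ ^ 2 ≤ C) →
          u a = s.u (S.τ k) → ∀ t ∈ Icc a b, ∀ x, ‖u t x‖ ≤ B) :
    ¬ HeredityFrom k := by
  obtain ⟨S, s, B, hP, hR, hQ, hbd⟩ := hW
  refine not_heredityFrom_of_cappedClassStage hk (𝒜 := {s.u (S.τ k)}) (Φ := fun _ => B) ?_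
    ⟨S, s, hP, hR, hQ, Set.mem_singleton _⟩
  intro a b hab f u p hcl hf0 hE hA t ht x
  exact hbd hab f u p hcl hf0 hE (Set.mem_singleton_iff.1 hA) t ht x

end Summit.NavierStokesRegularity.HeredityAtOneSpeedCap
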